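import Summits.QuantumFields.YangMills.Theorems.CurvatureKernelBound.Negative.L1Kernel

/-!
# `CurvatureKernelBound` — negative lemmas, `ℓ¹` witness II: flat decay on `⁰𝒮` and the dominated integrand

Supports crux item `stmt-QuantumFields-11687` (`PencilRigidity.CurvatureKernelBound`). Standing disprover's negative
lemmas (refuter, cdisprove cycle 3), ORDER-INSUFFICIENCY WITH REGULARITY chain `L1Kernel → L1Flat → L1Extension →
L1Package → L1RPKernel → L1RP → L1Main`, culminating in `L1Witness.not_axialGrowthOfTwoPointPackage`: the two-point
shadow of `W₁ ∖ lattice` plus a representing kernel continuous off `0` do NOT imply the axial growth bound of Stub E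
(`AxialGrowth`) of line `sixteen-charts-analytic-kernel`. No conclusion below asserts a Theses statement positively.

`norm_le_flat_of_isOffDiagonal`: an off-diagonal Schwartz function vanishes to every order `N` at the diagonal with
Schwartz decay, `‖F x‖ ≤ 3ᵏ (‖x₀−x₁‖/2)ᴺ (1+‖x‖)⁻ᵏ · SN k N F` for `‖x₀−x₁‖ ≤ 1` (Taylor along the segment to the
nearest diagonal point through the one-variable flatness lemma `norm_iteratedDeriv_le_of_flat`) — the analytic core
of Stub A4 `OffDiagonalExtension`. Consequences for the witness: `‖K(x₀−x₁) F(x)‖ ≤ 9!·3⁹ (1+‖x‖)⁻⁹ SN 9 10 F`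
(`norm_KC_mul_le`: ten orders of flatness pay the `‖w‖⁻¹⁰`), integrability (`integrable_KC_mul`) and the seminorm
bound `‖∫ K F‖ ≤ Cbd · SN 9 10 F` on `⁰𝒮` (`norm_integral_KC_mul_le`). [folklore]
-/

open scoped BigOperators Topology SchwartzMap
open MeasureTheory Filter Set Real
open Literature.MathematicalPhysics.QuantumLattice Literature.MathematicalPhysics.AQFT

noncomputable section

namespace Summit.QuantumFields.YangMills.Theorems.CurvatureKernelBound.Negative

namespace L1Witness

/-! ### Flatness of off-diagonal test functions at the diagonal -/

section Flat

variable (x : Fin 2 → E4)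

/-- The nearest diagonal configuration `((x₀+x₁)/2, (x₀+x₁)/2)`. -/
def diagPt : Fin 2 → E4 := fun _ => (1 / 2 : ℝ) • (x 0 + x 1)

/-- The offset `x - diagPt x = ((x₀-x₁)/2, (x₁-x₀)/2)`. -/
def offV : Fin 2 → E4 := x - diagPt x

/-- Auxiliary fact `diagPt_mem` of the `ℓ¹`-witness construction (see the module docstring). [folklore] -/
theorem diagPt_mem : diagPt x ∈ coincidenceLocus 2 E4 := ⟨0, 1, by decide, rfl⟩

/-- Auxiliary fact `diagPt_add_offV` of the `ℓ¹`-witness construction (see the module docstring). [folklore] -/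
theorem diagPt_add_offV : diagPt x + offV x = x := by simp [offV]

/-- Auxiliary fact `offV_apply_zero` of the `ℓ¹`-witness construction (see the module docstring). [folklore] -/
theorem offV_apply_zero : offV x 0 = (1 / 2 : ℝ) • (x 0 - x 1) := by
  simp only [offV, diagPt, Pi.sub_apply]; module

/-- Auxiliary fact `offV_apply_one` of the `ℓ¹`-witness construction (see the module docstring). [folklore] -/
theorem offV_apply_one : offV x 1 = -((1 / 2 : ℝ) • (x 0 - x 1)) := by
  simp only [offV, diagPt, Pi.sub_apply]; module

/-- Auxiliary fact `norm_offV_le` of the `ℓ¹`-witness construction (see the module docstring). [folklore] -/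
theorem norm_offV_le : ‖offV x‖ ≤ ‖x 0 - x 1‖ / 2 := by
  refine (pi_norm_le_iff_of_nonneg (by positivity)).2 fun i => ?_
  fin_cases i
  · show ‖offV x 0‖ ≤ _
    rw [offV_apply_zero, norm_smul]; norm_num
    exact le_of_eq (by ring)
  · show ‖offV x 1‖ ≤ _
    rw [offV_apply_one, norm_neg, norm_smul]; norm_num
    exact le_of_eq (by ring)

variable {x}

/-- Iterated derivatives of the restriction of a test function to a line. -/
theorem iteratedDeriv_lineAt (n : ℕ) (F : 𝓢((Fin 2 → E4), ℂ)) (y v : Fin 2 → E4) (t : ℝ) :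
    iteratedDeriv n (fun s : ℝ => F (y + s • v)) t = iteratedFDeriv ℝ n F (y + t • v) (fun _ => v) := by
  rw [iteratedDeriv_eq_iteratedFDeriv]
  let g : ℝ →L[ℝ] (Fin 2 → E4) := ContinuousLinearMap.toSpanSingleton ℝ v
  have hfun : (fun s : ℝ => F (y + s • v)) = (fun z : Fin 2 → E4 => F (z + y)) ∘ g := by
    funext s
    simp [g, ContinuousLinearMap.toSpanSingleton_apply, add_comm]
  have hF : ContDiff ℝ n (fun z : Fin 2 → E4 => F (z + y)) :=
    (F.smooth n).comp (contDiff_id.add contDiff_const)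
  rw [hfun, ContinuousLinearMap.iteratedFDeriv_comp_right g hF t le_rfl]
  simp only [ContinuousMultilinearMap.compContinuousLinearMap_apply]
  rw [iteratedFDeriv_comp_add_right' n y]
  simp [g, ContinuousLinearMap.toSpanSingleton_apply, add_comm]

/-- One-variable flatness: if all derivatives of order `< N` of a smooth `g` vanish at `0` and the
`N`-th is bounded by `B` on `[0,1]`, then all derivatives of order `≤ N` are bounded by `B` there. -/
theorem norm_iteratedDeriv_le_of_flat {g : ℝ → ℂ} {N : ℕ} {B : ℝ} (hB : 0 ≤ B)
    (hdiff : ∀ j < N, Differentiable ℝ (iteratedDeriv j g))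
    (h0 : ∀ j < N, iteratedDeriv j g 0 = 0)
    (hN : ∀ t ∈ Icc (0 : ℝ) 1, ‖iteratedDeriv N g t‖ ≤ B) :
    ∀ j ≤ N, ∀ t ∈ Icc (0 : ℝ) 1, ‖iteratedDeriv j g t‖ ≤ B := by
  intro j hj
  induction hdist : N - j generalizing j with
  | zero =>
    have : j = N := by omega
    subst this; exact hN
  | succ d ih =>
    have hjN : j < N := by omega
    have hsucc := ih (j + 1) (by omega) (by omega)
    intro t ht
    have hderiv : ∀ s ∈ Icc (0 : ℝ) 1,
        HasDerivWithinAt (iteratedDeriv j g) (iteratedDeriv (j + 1) g s) (Icc 0 1) s := by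
      intro s _
      have h := ((hdiff j hjN) s).hasDerivAt
      rw [iteratedDeriv_succ]
      exact h.hasDerivWithinAt
    have hmvt := norm_image_sub_le_of_norm_deriv_le_segment' hderiv
      (fun s hs => hsucc s (Ico_subset_Icc_self hs)) t ht
    rw [h0 j hjN, sub_zero] at hmvt
    calc ‖iteratedDeriv j g t‖ ≤ B * (t - 0) := hmvt
      _ ≤ B * 1 := by gcongr; linarith [ht.2]
      _ = B := mul_one B

/-- The finite family of Schwartz seminorms of orders `≤ (k, n)`. -/
abbrev SN (k n : ℕ) (F : 𝓢((Fin 2 → E4), ℂ)) : ℝ :=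
  (Finset.Iic (k, n)).sup (fun m => SchwartzMap.seminorm ℂ m.1 m.2) F

/-- Auxiliary fact `SN_nonneg` of the `ℓ¹`-witness construction (see the module docstring). [folklore] -/
theorem SN_nonneg (k n : ℕ) (F : 𝓢((Fin 2 → E4), ℂ)) : 0 ≤ SN k n F := apply_nonneg _ _

/-- **Flat decay at the diagonal.** An off-diagonal test function vanishes to order `N` at the
diagonal, with Schwartz decay: for `‖x₀ - x₁‖ ≤ 1`,
`‖F x‖ ≤ 3ᵏ (‖x₀-x₁‖/2)ᴺ (1+‖x‖)⁻ᵏ · SN k N F`. -/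
theorem norm_le_flat_of_isOffDiagonal {F : 𝓢((Fin 2 → E4), ℂ)} (hF : IsOffDiagonal F) (k N : ℕ)
    (x : Fin 2 → E4) (hx : ‖x 0 - x 1‖ ≤ 1) :
    ‖F x‖ ≤ 3 ^ k * (‖x 0 - x 1‖ / 2) ^ N * (1 + ‖x‖)⁻¹ ^ k * SN k N F := by
  set y := diagPt x with hy
  set v := offV x with hv
  have hvn : ‖v‖ ≤ ‖x 0 - x 1‖ / 2 := norm_offV_le x
  have hv2 : ‖v‖ ≤ 1 / 2 := hvn.trans (by linarith)
  set g : ℝ → ℂ := fun s => F (y + s • v) with hg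
  -- weight comparison along the segment
  have hweight : ∀ t ∈ Icc (0 : ℝ) 1, (1 + ‖y + t • v‖)⁻¹ ≤ 3 / 2 * (1 + ‖x‖)⁻¹ := by
    intro t ht
    have hxz : ‖x‖ ≤ ‖y + t • v‖ + 1 / 2 := by
      have : x = (y + t • v) + (1 - t) • v := by
        rw [← diagPt_add_offV x, ← hy, ← hv]; module
      calc ‖x‖ = ‖(y + t • v) + (1 - t) • v‖ := by rw [← this]
        _ ≤ ‖y + t • v‖ + ‖(1 - t) • v‖ := norm_add_le _ _
        _ ≤ ‖y + t • v‖ + 1 / 2 := by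
            rw [norm_smul, Real.norm_of_nonneg (by linarith [ht.2])]
            nlinarith [ht.1, ht.2, norm_nonneg v]
    have hxz' : 1 + ‖x‖ ≤ 3 / 2 * (1 + ‖y + t • v‖) := by nlinarith [norm_nonneg (y + t • v)]
    calc (1 + ‖y + t • v‖)⁻¹ = 3 / 2 * (3 / 2 * (1 + ‖y + t • v‖))⁻¹ := by
          field_simp
      _ ≤ 3 / 2 * (1 + ‖x‖)⁻¹ := by
          gcongr 3 / 2 * ?_
          exact inv_anti₀ (by positivity) hxz'
  -- the bound on the N-th derivative along the segment
  set B := 3 ^ k * (‖x 0 - x 1‖ / 2) ^ N * (1 + ‖x‖)⁻¹ ^ k * SN k N F with hB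
  have hB0 : 0 ≤ B := by positivity
  have hN : ∀ t ∈ Icc (0 : ℝ) 1, ‖iteratedDeriv N g t‖ ≤ B := by
    intro t ht
    rw [hg, iteratedDeriv_lineAt]
    have h1 : ‖iteratedFDeriv ℝ N F (y + t • v) (fun _ => v)‖ ≤
        ‖iteratedFDeriv ℝ N F (y + t • v)‖ * ‖v‖ ^ N := by
      have := (iteratedFDeriv ℝ N F (y + t • v)).le_opNorm (fun _ => v)
      simpa [Finset.prod_const] using this
    have h2 : (1 + ‖y + t • v‖) ^ k * ‖iteratedFDeriv ℝ N F (y + t • v)‖ ≤ 2 ^ k * SN k N F :=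
      SchwartzMap.one_add_le_sup_seminorm_apply (m := (k, N)) le_rfl le_rfl F _
    have hpos : 0 < (1 + ‖y + t • v‖) ^ k := by positivity
    have h3 : ‖iteratedFDeriv ℝ N F (y + t • v)‖ ≤ 2 ^ k * SN k N F * (1 + ‖y + t • v‖)⁻¹ ^ k := by
      rw [inv_pow, ← div_eq_mul_inv, le_div_iff₀ hpos, mul_comm]
      exact h2
    have h4 : (1 + ‖y + t • v‖)⁻¹ ^ k ≤ (3 / 2) ^ k * (1 + ‖x‖)⁻¹ ^ k := by
      rw [← mul_pow]
      exact pow_le_pow_left₀ (by positivity) (hweight t ht) k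
    have h5 : ‖v‖ ^ N ≤ (‖x 0 - x 1‖ / 2) ^ N := pow_le_pow_left₀ (norm_nonneg _) hvn N
    calc ‖iteratedFDeriv ℝ N F (y + t • v) (fun _ => v)‖
        ≤ ‖iteratedFDeriv ℝ N F (y + t • v)‖ * ‖v‖ ^ N := h1
      _ ≤ (2 ^ k * SN k N F * (1 + ‖y + t • v‖)⁻¹ ^ k) * (‖x 0 - x 1‖ / 2) ^ N := by
          gcongr
      _ ≤ (2 ^ k * SN k N F * ((3 / 2) ^ k * (1 + ‖x‖)⁻¹ ^ k)) * (‖x 0 - x 1‖ / 2) ^ N := by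
          gcongr
      _ = B := by
          rw [hB, show (3 : ℝ) ^ k = 2 ^ k * (3 / 2) ^ k by rw [← mul_pow]; norm_num]
          ring
  -- vanishing of the low derivatives at the diagonal point
  have h0 : ∀ j < N, iteratedDeriv j g 0 = 0 := by
    intro j _
    rw [hg, iteratedDeriv_lineAt, zero_smul, add_zero, hF y (diagPt_mem x) j]
    rfl
  have hdiff : ∀ j < N, Differentiable ℝ (iteratedDeriv j g) := by
    intro j hj
    have hsmooth : ContDiff ℝ N g :=
      (F.smooth N).comp ((contDiff_const.add (contDiff_id.smul contDiff_const)))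
    exact hsmooth.differentiable_iteratedDeriv j (by exact_mod_cast hj)
  have := norm_iteratedDeriv_le_of_flat hB0 hdiff h0 hN 0 (Nat.zero_le N) 1 ⟨zero_le_one, le_rfl⟩
  rw [iteratedDeriv_zero, hg] at this
  simp only [one_smul] at this
  rwa [hy, hv, diagPt_add_offV] at this

/-- Plain Schwartz decay `‖F x‖ ≤ 2ᵏ (1+‖x‖)⁻ᵏ SN k 0 F`. -/
theorem norm_le_SN (F : 𝓢((Fin 2 → E4), ℂ)) (k : ℕ) (x : Fin 2 → E4) :
    ‖F x‖ ≤ 2 ^ k * (1 + ‖x‖)⁻¹ ^ k * SN k 0 F := by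
  have h : (1 + ‖x‖) ^ k * ‖F x‖ ≤ 2 ^ k * SN k 0 F := by
    simpa [norm_iteratedFDeriv_zero] using
      SchwartzMap.one_add_le_sup_seminorm_apply (𝕜 := ℂ) (m := (k, 0)) le_rfl le_rfl F x
  have hpos : 0 < (1 + ‖x‖) ^ k := by positivity
  have h' : ‖F x‖ ≤ (2 ^ k * SN k 0 F) / (1 + ‖x‖) ^ k := by
    rw [le_div_iff₀ hpos, mul_comm]; exact h
  calc ‖F x‖ ≤ (2 ^ k * SN k 0 F) / (1 + ‖x‖) ^ k := h'
    _ = 2 ^ k * (1 + ‖x‖)⁻¹ ^ k * SN k 0 F := by rw [inv_pow]; ring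

/-- Auxiliary fact `SN_mono_right` of the `ℓ¹`-witness construction (see the module docstring). [folklore] -/
theorem SN_mono_right {k n n' : ℕ} (h : n ≤ n') (F : 𝓢((Fin 2 → E4), ℂ)) : SN k n F ≤ SN k n' F :=
  Seminorm.le_def.1 (Finset.sup_mono (Finset.Iic_subset_Iic.2
    (show ((k, n) : ℕ × ℕ) ≤ (k, n') from Prod.mk_le_mk.2 ⟨le_rfl, h⟩))) F

end Flat


/-! ### The two-point integrand `K(x₀−x₁) F(x)`: domination, integrability, seminorm bound -/

section Integrand

/-- The kernel on configurations, complex-valued: `KC x = K(x₀ − x₁)`. -/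
def KC (x : Fin 2 → E4) : ℂ := (Kw (x 0 - x 1) : ℂ)

/-- Auxiliary fact `KC_apply` of the `ℓ¹`-witness construction (see the module docstring). [folklore] -/
theorem KC_apply (x : Fin 2 → E4) : KC x = (Kw (x 0 - x 1) : ℂ) := rfl

/-- Auxiliary fact `measurable_KC` of the `ℓ¹`-witness construction (see the module docstring). [folklore] -/
theorem measurable_KC : Measurable KC :=
  Complex.measurable_ofReal.comp (measurable_Kw.comp ((measurable_pi_apply 0).sub (measurable_pi_apply 1)))

/-- Auxiliary fact `norm_KC` of the `ℓ¹`-witness construction (see the module docstring). [folklore] -/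
theorem norm_KC (x : Fin 2 → E4) : ‖KC x‖ = Kw (x 0 - x 1) := by
  rw [KC, Complex.norm_real, Real.norm_of_nonneg (Kw_nonneg _)]

/-- The integrable dominator `(1 + ‖x‖)⁻⁹` on `(ℝ⁴)²`. -/
def wt (x : Fin 2 → E4) : ℝ := (1 + ‖x‖)⁻¹ ^ 9

/-- Auxiliary fact `wt_nonneg` of the `ℓ¹`-witness construction (see the module docstring). [folklore] -/
theorem wt_nonneg (x : Fin 2 → E4) : 0 ≤ wt x := by unfold wt; positivity

/-- Auxiliary fact `finrank_config` of the `ℓ¹`-witness construction (see the module docstring). [folklore] -/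
theorem finrank_config : Module.finrank ℝ (Fin 2 → E4) = 8 := by
  simp [Module.finrank_pi_fintype]

/-- Auxiliary fact `integrable_wt` of the `ℓ¹`-witness construction (see the module docstring). [folklore] -/
theorem integrable_wt : Integrable wt := by
  have h := integrable_one_add_norm (E := Fin 2 → E4) (μ := volume) (r := 9)
    (by rw [finrank_config]; norm_num)
  refine h.congr (ae_of_all _ fun x => ?_)
  show (1 + ‖x‖) ^ (-(9 : ℝ)) = (1 + ‖x‖)⁻¹ ^ 9
  rw [Real.rpow_neg (by positivity), show (9 : ℝ) = ((9 : ℕ) : ℝ) by norm_num,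
    Real.rpow_natCast, inv_pow]

/-- The domination constant `9! · 3⁹`. -/
def Cdom : ℝ := Nat.factorial 9 * 3 ^ 9

/-- Auxiliary fact `Cdom_pos` of the `ℓ¹`-witness construction (see the module docstring). [folklore] -/
theorem Cdom_pos : 0 < Cdom := by unfold Cdom; positivity

/-- **Domination**: for an off-diagonal `F`, `‖K(x₀−x₁) F(x)‖ ≤ 9!·3⁹ (1+‖x‖)⁻⁹ SN 9 10 F`
(near the diagonal the `‖x₀−x₁‖⁻¹⁰` of the kernel is paid by ten orders of flatness). -/
theorem norm_KC_mul_le {F : 𝓢((Fin 2 → E4), ℂ)} (hF : IsOffDiagonal F) (x : Fin 2 → E4) :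
    ‖KC x * F x‖ ≤ Cdom * wt x * SN 9 10 F := by
  have hrhs : 0 ≤ Cdom * wt x * SN 9 10 F :=
    mul_nonneg (mul_nonneg Cdom_pos.le (wt_nonneg x)) (SN_nonneg _ _ _)
  by_cases hw : x 0 - x 1 = 0
  · have hx : x ∈ coincidenceLocus 2 E4 := ⟨0, 1, by decide, sub_eq_zero.1 hw⟩
    rw [hF.apply_eq_zero hx, mul_zero, norm_zero]
    exact hrhs
  rw [norm_mul, norm_KC]
  have hK := Kw_le hw
  have hwpos : 0 < ‖x 0 - x 1‖ := norm_pos_iff.2 hw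
  by_cases h1 : ‖x 0 - x 1‖ ≤ 1
  · have hFx := norm_le_flat_of_isOffDiagonal hF 9 10 x h1
    have hprod : ‖x 0 - x 1‖⁻¹ ^ 10 * (‖x 0 - x 1‖ / 2) ^ 10 = (1 / 2) ^ 10 := by
      rw [← mul_pow]; congr 1; field_simp
    calc Kw (x 0 - x 1) * ‖F x‖
        ≤ (Nat.factorial 9 * ‖x 0 - x 1‖⁻¹ ^ 10) *
            (3 ^ 9 * (‖x 0 - x 1‖ / 2) ^ 10 * (1 + ‖x‖)⁻¹ ^ 9 * SN 9 10 F) :=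
          mul_le_mul hK hFx (norm_nonneg _) (by positivity)
      _ = Nat.factorial 9 * 3 ^ 9 * (‖x 0 - x 1‖⁻¹ ^ 10 * (‖x 0 - x 1‖ / 2) ^ 10) *
            (1 + ‖x‖)⁻¹ ^ 9 * SN 9 10 F := by ring
      _ = Nat.factorial 9 * 3 ^ 9 * (1 / 2) ^ 10 * (1 + ‖x‖)⁻¹ ^ 9 * SN 9 10 F := by rw [hprod]
      _ ≤ Nat.factorial 9 * 3 ^ 9 * 1 * (1 + ‖x‖)⁻¹ ^ 9 * SN 9 10 F := by
          gcongr; norm_num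
      _ = Cdom * wt x * SN 9 10 F := by rw [Cdom, wt]; ring
  · have h1' : 1 < ‖x 0 - x 1‖ := lt_of_not_ge h1
    have hinv : ‖x 0 - x 1‖⁻¹ ^ 10 ≤ 1 := pow_le_one₀ (by positivity) (inv_le_one_of_one_le₀ h1'.le)
    have hK' : Kw (x 0 - x 1) ≤ Nat.factorial 9 := by
      calc Kw (x 0 - x 1) ≤ Nat.factorial 9 * ‖x 0 - x 1‖⁻¹ ^ 10 := hK
        _ ≤ Nat.factorial 9 * 1 := by gcongr
        _ = Nat.factorial 9 := mul_one _
    have hFx : ‖F x‖ ≤ 2 ^ 9 * (1 + ‖x‖)⁻¹ ^ 9 * SN 9 10 F :=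
      (norm_le_SN F 9 x).trans (by
        gcongr
        exact SN_mono_right (Nat.zero_le 10) F)
    calc Kw (x 0 - x 1) * ‖F x‖ ≤ Nat.factorial 9 * (2 ^ 9 * (1 + ‖x‖)⁻¹ ^ 9 * SN 9 10 F) :=
          mul_le_mul hK' hFx (norm_nonneg _) (by positivity)
      _ ≤ Nat.factorial 9 * (3 ^ 9 * (1 + ‖x‖)⁻¹ ^ 9 * SN 9 10 F) := by
          gcongr; norm_num
      _ = Cdom * wt x * SN 9 10 F := by rw [Cdom, wt]; ring

/-- Auxiliary fact `aestronglyMeasurable_KC_mul` of the `ℓ¹`-witness construction (see the module docstring). [folklore] -/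
theorem aestronglyMeasurable_KC_mul (F : 𝓢((Fin 2 → E4), ℂ)) :
    AEStronglyMeasurable (fun x => KC x * F x) volume :=
  (measurable_KC.aestronglyMeasurable).mul F.continuous.aestronglyMeasurable

/-- **Integrability** of `K(x₀−x₁) F(x)` for off-diagonal `F`. -/
theorem integrable_KC_mul {F : 𝓢((Fin 2 → E4), ℂ)} (hF : IsOffDiagonal F) :
    Integrable (fun x => KC x * F x) :=
  Integrable.mono' ((integrable_wt.const_mul Cdom).mul_const (SN 9 10 F))
    (aestronglyMeasurable_KC_mul F) (ae_of_all _ (norm_KC_mul_le hF))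

/-- The constant of the seminorm bound. -/
def Cbd : ℝ := Cdom * ∫ x, wt x

/-- Auxiliary fact `Cbd_nonneg` of the `ℓ¹`-witness construction (see the module docstring). [folklore] -/
theorem Cbd_nonneg : 0 ≤ Cbd := mul_nonneg Cdom_pos.le (integral_nonneg wt_nonneg)

/-- **Seminorm bound** `‖∫ K F‖ ≤ Cbd · SN 9 10 F` on `⁰𝒮`. -/
theorem norm_integral_KC_mul_le {F : 𝓢((Fin 2 → E4), ℂ)} (hF : IsOffDiagonal F) :
    ‖∫ x, KC x * F x‖ ≤ Cbd * SN 9 10 F := by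
  calc ‖∫ x, KC x * F x‖ ≤ ∫ x, Cdom * wt x * SN 9 10 F :=
        norm_integral_le_of_norm_le ((integrable_wt.const_mul Cdom).mul_const (SN 9 10 F))
          (ae_of_all _ (norm_KC_mul_le hF))
    _ = Cbd * SN 9 10 F := by
        rw [integral_mul_const, integral_const_mul, Cbd]

end Integrand

end L1Witness

end Summit.QuantumFields.YangMills.Theorems.CurvatureKernelBound.Negative
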